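import Mathlib.RingTheory.DedekindDomain.SInteger
import Mathlib.RingTheory.DedekindDomain.AdicValuation
import Mathlib.NumberTheory.NumberField.Basic
import Mathlib.GroupTheory.Index
import Mathlib.LinearAlgebra.FreeModule.IdealQuotient
import Mathlib.NumberTheory.NumberField.Basic
import HarnessLib

/-!
# X3, the DEGENERATE rows, class-level count: CUBES MODULO `9` — `x³ ≡ 1 (mod 9) ⟹ x ≡ 1 (mod 3)`
# at primes of ODD ramification over `3`, and the bound `#((R/9R)ˣ/cubes) ≤ #(𝓞_K/3𝓞_K)` for the
# `S`-integers `R` of a number field (cell `bsd-eis`, seat `bsd-eis-x3` gen 9; brick U1 of x3-MEMO-11;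
# route K1 `AdditiveBranchIMC`, crux `GordTwoRankZeroOffCaseOne` — supports only)

HONEST FRAMING (`run/shared/lean/pub/bsd-eis/README.md` §4): THEOREMS ONLY (no `def`, no named fact,
no `sorry`); nothing is booked; no label, tier or count of record moves.

## Why

In the class-level U-side count (x3-MEMO-11) the local cube condition at `3` for an `S`-unit `u` of a
layer `ℚ_n` is the CONGRUENCE `u ≡ cube (mod 9R)`, `R` the `S`-integers (then `u·D³ = 1 + 9T` and the
Banach lemma of `X3BranchKummerCubeAtThreeBasis.lean` produces the good cube roots); the number of
independent kernel elements is `#S − 1` as soon as the target `(R/9R)ˣ/cubes` has order `≤ 3^{[ℚ_n:ℚ]}`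
(brick D, `X3BranchKernelFamilyModPowers.lean`). This file proves that bound from VALUATIONS only (no
completion, no logarithm): at a prime `𝔭 ∣ 3` with ODD `e = v_𝔭(3)` (every `e ∣ [ℚ_n:ℚ] = 3ⁿ` is odd),
`v_𝔭(x) ≥ 0` and `v_𝔭(x³ − 1) ≥ 2e` force `v_𝔭(x − 1) ≥ e`, because with `y = x − 1`,
`x³ − 1 = y(y² + 3x)` and `v(y²) = 2v(y) ≠ e = v(3x)` by parity; hence `(R/9R)ˣ[3] ⊆ 1 + 3R/9R`, whose
order is at most `#(R/3R) ≤ #(𝓞_K/3𝓞_K)`.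

## What
* §1 `KummerFamily.valuation_sub_one_le_of_cube` — the valuation lemma (any valuation `w : K → ℤᵐ⁰`
  with `w 3 = exp(−e)`, `e` odd).
* §2 `KummerFamily.sub_one_mem_of_cube_sub_one_mem` — in the `S`-integers `R` of a number field `K`
  all of whose primes above `3` have odd ramification: `x³ − 1 ∈ 9R ⟹ x − 1 ∈ 3R`.
* §3 `KummerFamily.natCard_units_quot_cubes_le` — `#((R/9R)ˣ ⧸ cubes) ≤ #(𝓞_K ⧸ 3)` when `𝓞_K → R/9R`
  is onto (true for `S`-integers; supplied as a hypothesis `hsurj`).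
References: [NeukirchANT1999] Ch. II (3.8)–(3.9) (valuations of a Dedekind domain), Ch. I (11.6);
[SerreLocalFields1979] Ch. XIV §4 (method: filtration of units).
-/

set_option autoImplicit false

noncomputable section

open scoped Classical

namespace Summit.BirchSwinnertonDyer.Rank1Residual.Additive

namespace KummerFamily

open WithZero

/-! ### §1 The valuation lemma -/

/-- **`v(x) ≥ 0`, `v(x³ − 1) ≥ 2v(3)`, `v(3)` ODD ⟹ `v(x − 1) ≥ v(3)`** for a valuation `w` into `ℤᵐ⁰`
(written multiplicatively: `w x ≤ 1`, `w (x³−1) ≤ (w 3)²` ⟹ `w (x−1) ≤ w 3`). With `y = x − 1`: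
if `w x < 1` then `w(x³ − 1) = 1 > (w 3)²`; if `w x = 1` then `x³ − 1 = y (y² + 3x)` with
`w(y²) = (w y)² ≠ w 3` by parity, so `w(x³−1) ≥ w y · w 3 > (w 3)²` whenever `w y > w 3`.
[cite: NeukirchANT1999, Ch. II (3.8)–(3.9)] -/
theorem valuation_sub_one_le_of_cube {K : Type*} [Field K] (w : Valuation K ℤᵐ⁰) {e : ℕ}
    (hodd : Odd e) (h3 : w 3 = exp (-(e : ℤ))) {x : K} (hx : w x ≤ 1)
    (hcube : w (x ^ 3 - 1) ≤ w 3 ^ 2) : w (x - 1) ≤ w 3 := by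
  have he0 : 0 < e := hodd.pos
  have h9 : w 3 ^ 2 = exp (-(2 * (e : ℤ))) := by
    rw [h3, ← exp_nsmul]; congr 1; ring
  by_contra hlt
  rw [not_le] at hlt
  rcases hx.lt_or_eq with hxlt | hxeq
  · -- `w x < 1`: then `x - 1` and `x³ - 1` are units
    have h1 : w (x ^ 3 - 1) = 1 := by
      rw [sub_eq_add_neg, Valuation.map_add_eq_of_lt_right]
      · rw [Valuation.map_neg, Valuation.map_one]
      · rw [Valuation.map_neg, Valuation.map_one, Valuation.map_pow]
        exact pow_lt_one₀ zero_le hxlt three_ne_zero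
    rw [h1, h9] at hcube
    have : (0 : ℤ) ≤ -(2 * (e : ℤ)) := by
      rw [← exp_le_exp, exp_zero]; exact hcube
    omega
  · -- `w x = 1`
    set y : K := x - 1 with hy
    have hy0 : w y ≠ 0 := by
      intro h0; rw [h0] at hlt; exact (not_lt.mpr zero_le) hlt
    set i : ℤ := log (w y) with hi
    have hwy : w y = exp i := by rw [hi, exp_log hy0]
    have hfac : x ^ 3 - 1 = y * (y ^ 2 + 3 * x) := by rw [hy]; ring
    have h3x : w (3 * x) = exp (-(e : ℤ)) := by rw [Valuation.map_mul, hxeq, mul_one, h3]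
    have hy2 : w (y ^ 2) = exp (2 * i) := by
      rw [Valuation.map_pow, hwy, ← exp_nsmul]; congr 1
    have hne : w (y ^ 2) ≠ w (3 * x) := by
      rw [hy2, h3x]
      intro h
      have h' : 2 * i = -(e : ℤ) := exp_injective h
      obtain ⟨k, hk⟩ := hodd
      omega
    have hsum : exp (-(e : ℤ)) ≤ w (y ^ 2 + 3 * x) := by
      rw [Valuation.map_add_of_distinct_val _ hne, h3x]
      exact le_max_right _ _
    have hie : -(e : ℤ) < i := by
      rw [← exp_lt_exp, ← h3, ← hwy]; exact hlt
    have hprod : exp (i + -(e : ℤ)) ≤ w (x ^ 3 - 1) := by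
      rw [hfac, Valuation.map_mul, hwy, exp_add]
      exact mul_le_mul_right hsum _
    have := hprod.trans hcube
    rw [h9, exp_le_exp] at this
    omega


/-! ### §2 In the `S`-integers: `x³ − 1 ∈ 9R ⟹ x − 1 ∈ 3R` -/

section SIntegers

open NumberField IsDedekindDomain

variable {K : Type*} [Field K] [NumberField K] (S : Set (HeightOneSpectrum (𝓞 K)))

/-- **`x³ ≡ 1 (mod 9R) ⟹ x ≡ 1 (mod 3R)` in the `S`-integers `R` of a number field `K`**, when every
prime above `3` has ODD absolute ramification index (`v(3) = exp(−e)`, `e` odd): membership in `R` is a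
valuation condition at the `v ∉ S`, checked with §1 at `v ∣ 3` and trivially at `v ∤ 3` (at the primes
of `S` there is nothing to check, so `S` need not avoid `3`). [cite: NeukirchANT1999, Ch. II (3.8)–(3.9), Ch. I (11.6)] -/
theorem sub_one_mem_of_cube_sub_one_mem
    (hodd : ∀ v : HeightOneSpectrum (𝓞 K), (3 : 𝓞 K) ∈ v.asIdeal →
      ∃ e : ℕ, Odd e ∧ v.valuation K (3 : K) = exp (-(e : ℤ)))
    (x : S.integer K) (hx : x ^ 3 - 1 ∈ Ideal.span {(9 : S.integer K)}) :
    x - 1 ∈ Ideal.span {(3 : S.integer K)} := by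
  rw [Ideal.mem_span_singleton'] at hx ⊢
  obtain ⟨a, ha⟩ := hx
  have h9c : ((9 : S.integer K) : K) = 9 := by norm_cast
  have h3c : ((3 : S.integer K) : K) = 3 := by norm_cast
  have ha' : (a : K) * 9 = (x : K) ^ 3 - 1 := by
    have := congrArg (fun z : S.integer K ↦ (z : K)) ha
    simpa [h9c] using this
  -- the candidate `b = (x - 1)/3`
  have h3K : (3 : K) ≠ 0 := by norm_num
  have hval : ∀ v : HeightOneSpectrum (𝓞 K), v ∉ S → v.valuation K (((x : K) - 1) / 3) ≤ 1 := by
    intro v hvS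
    have hxv : v.valuation K (x : K) ≤ 1 := x.2 v hvS
    have hav : v.valuation K (a : K) ≤ 1 := a.2 v hvS
    rw [map_div₀, div_le_one₀ ((Valuation.pos_iff _).mpr h3K)]
    by_cases h3v : (3 : 𝓞 K) ∈ v.asIdeal
    · obtain ⟨e, he, h3⟩ := hodd v h3v
      refine valuation_sub_one_le_of_cube (v.valuation K) he h3 hxv ?_
      rw [← ha', Valuation.map_mul, show (9 : K) = 3 ^ 2 by norm_num, Valuation.map_pow]
      exact mul_le_of_le_one_left zero_le hav
    · have h31 : v.valuation K (3 : K) = 1 := by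
        have := (v.valuation_eq_one_iff_notMem (K := K)).mpr h3v
        rwa [map_ofNat] at this
      rw [h31]
      have h1 : ((x : K) - 1) = ((x - 1 : S.integer K) : K) := by simp
      rw [h1]
      exact (x - 1).2 v hvS
  refine ⟨⟨((x : K) - 1) / 3, fun v hv ↦ hval v hv⟩, ?_⟩
  apply Subtype.ext
  simp only [Subalgebra.coe_mul, Subalgebra.coe_sub, Subalgebra.coe_one, h3c]
  field_simp

/-! ### §3 The count `#((R/9R)ˣ ⧸ cubes) ≤ #(𝓞_K ⧸ 3)` -/

/-- **`#((R/9R)ˣ ⧸ cubes) ≤ #(𝓞_K ⧸ 3𝓞_K)`** for the `S`-integers `R` of `K` under the hypotheses of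
§2 and the surjectivity of `𝓞_K → R/9R` (true for `S`-integers: denominators are invertible mod `9`):
`(R/9R)ˣ/cubes` has the order of `(R/9R)ˣ[3] ⊆ {1 + 3r}`, and `r` may be taken in `𝓞_K` modulo `3`.
[cite: NeukirchANT1999, Ch. I (11.6), Ch. II (3.8)–(3.9)] -/
theorem natCard_units_quot_cubes_le
    (hodd : ∀ v : HeightOneSpectrum (𝓞 K), (3 : 𝓞 K) ∈ v.asIdeal →
      ∃ e : ℕ, Odd e ∧ v.valuation K (3 : K) = exp (-(e : ℤ)))
    (hsurj : Function.Surjective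
      ((Ideal.Quotient.mk (Ideal.span {(9 : S.integer K)})).comp (algebraMap (𝓞 K) (S.integer K)))) :
    Finite ((S.integer K ⧸ Ideal.span {(9 : S.integer K)})ˣ) ∧
    Nat.card ((S.integer K ⧸ Ideal.span {(9 : S.integer K)})ˣ ⧸
        (@powMonoidHom (S.integer K ⧸ Ideal.span {(9 : S.integer K)})ˣ _ 3).range) ≤
      Nat.card (𝓞 K ⧸ Ideal.span {(3 : 𝓞 K)}) := by
  set R := S.integer K
  set I9 : Ideal R := Ideal.span {(9 : R)} with hI9
  set Q := R ⧸ I9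
  set π : 𝓞 K →+* Q := (Ideal.Quotient.mk I9).comp (algebraMap (𝓞 K) R) with hπ
  -- finiteness of `Q` from `𝓞_K/9 ↠ Q`
  have h9ne : Ideal.span {(9 : 𝓞 K)} ≠ ⊥ := by
    rw [Ne, Ideal.span_singleton_eq_bot]; norm_num
  haveI : Finite (𝓞 K ⧸ Ideal.span {(9 : 𝓞 K)}) := Ideal.finiteQuotientOfFreeOfNeBot _ h9ne
  have h3ne : Ideal.span {(3 : 𝓞 K)} ≠ ⊥ := by
    rw [Ne, Ideal.span_singleton_eq_bot]; norm_num
  haveI : Finite (𝓞 K ⧸ Ideal.span {(3 : 𝓞 K)}) := Ideal.finiteQuotientOfFreeOfNeBot _ h3ne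
  have hker9 : ∀ r : 𝓞 K, r ∈ Ideal.span {(9 : 𝓞 K)} → π r = 0 := by
    intro r hr
    obtain ⟨c, rfl⟩ := Ideal.mem_span_singleton'.mp hr
    rw [hπ, RingHom.comp_apply, Ideal.Quotient.eq_zero_iff_mem, map_mul, hI9]
    exact Ideal.mul_mem_left _ _ (Ideal.subset_span (by rw [map_ofNat]; exact Set.mem_singleton _))
  let πbar : 𝓞 K ⧸ Ideal.span {(9 : 𝓞 K)} →+* Q :=
    Ideal.Quotient.lift _ π hker9
  have hπbar : Function.Surjective πbar := by
    intro q
    obtain ⟨r, hr⟩ := hsurj q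
    exact ⟨Ideal.Quotient.mk _ r, by rw [Ideal.Quotient.lift_mk]; exact hr⟩
  haveI hQfin : Finite Q := Finite.of_surjective πbar hπbar
  haveI : Finite Qˣ := instFiniteUnits
  refine ⟨‹Finite Qˣ›, ?_⟩
  -- `#(Qˣ/cubes) = #Qˣ[3]` (finite abelian group; cf. the tree's
  -- `Honda1971.index_range_powMonoidHom_eq_card_ker`, inlined to keep the import cone small)
  have hidx : (@powMonoidHom Qˣ _ 3).range.index = Nat.card (@powMonoidHom Qˣ _ 3).ker := by
    have h1 := ((@powMonoidHom Qˣ _ 3).range).index_mul_card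
    have h2 := ((@powMonoidHom Qˣ _ 3).ker).card_mul_index
    rw [Subgroup.index_ker] at h2
    have hr : Nat.card (@powMonoidHom Qˣ _ 3).range ≠ 0 := Nat.card_pos.ne'
    exact mul_right_cancel₀ hr (h1.trans h2.symm)
  rw [← Subgroup.index_eq_card, hidx]
  -- `Qˣ[3] ↪ {π(1 + 3 r₀) : r₀ ∈ 𝓞 K mod 3}`
  let g : 𝓞 K → Q := fun r ↦ π (1 + 3 * r)
  have hg3 : ∀ r r' : 𝓞 K, r - r' ∈ Ideal.span {(3 : 𝓞 K)} → g r = g r' := by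
    intro r r' h
    obtain ⟨c, hc⟩ := Ideal.mem_span_singleton'.mp h
    have : (1 + 3 * r) - (1 + 3 * r') = 9 * 0 + 3 * (c * 3) := by rw [hc]; ring
    change π (1 + 3 * r) = π (1 + 3 * r')
    rw [← sub_eq_zero, ← map_sub, this]
    apply hker9
    rw [Ideal.mem_span_singleton']
    exact ⟨c, by ring⟩
  -- every `u ∈ Qˣ[3]` is some `g r₀`
  have hrange : ∀ u : (@powMonoidHom Qˣ _ 3).ker, ∃ r₀ : 𝓞 K, ((u : Qˣ) : Q) = g r₀ := by
    intro u
    have hu : (u : Qˣ) ^ 3 = 1 := u.2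
    obtain ⟨x, hx⟩ := Ideal.Quotient.mk_surjective ((u : Qˣ) : Q)
    have hx3 : x ^ 3 - 1 ∈ I9 := by
      rw [← Ideal.Quotient.eq, map_pow, hx, map_one]
      have h := congrArg Units.val hu
      rwa [Units.val_pow_eq_pow_val, Units.val_one] at h
    obtain ⟨c, hc⟩ := Ideal.mem_span_singleton'.mp
      (sub_one_mem_of_cube_sub_one_mem S hodd x hx3)
    -- `c ≡ algebraMap r₀ (mod 9R)` by `hsurj`
    obtain ⟨r₀, hr₀⟩ := hsurj (Ideal.Quotient.mk I9 c)
    refine ⟨r₀, ?_⟩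
    have hxe : x = 1 + c * 3 := by rw [hc]; ring
    rw [← hx, hxe]
    have e1 : Ideal.Quotient.mk I9 (1 + c * 3) = 1 + Ideal.Quotient.mk I9 c * 3 := by
      simp [map_ofNat]
    have e2 : π (1 + 3 * r₀) = 1 + 3 * π r₀ := by simp [map_ofNat]
    rw [e1, show g r₀ = π (1 + 3 * r₀) from rfl, e2, hr₀, mul_comm]
  -- counting
  have hfinker : Finite (@powMonoidHom Qˣ _ 3).ker := inferInstance
  let G : 𝓞 K ⧸ Ideal.span {(3 : 𝓞 K)} → Q := fun q ↦ g (Classical.choose (Ideal.Quotient.mk_surjective q))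
  have hG : ∀ r : 𝓞 K, G (Ideal.Quotient.mk _ r) = g r := by
    intro r
    have h := Classical.choose_spec (Ideal.Quotient.mk_surjective (I := Ideal.span {(3 : 𝓞 K)})
      (Ideal.Quotient.mk _ r))
    exact hg3 _ _ ((Ideal.Quotient.eq).mp h)
  let F : (@powMonoidHom Qˣ _ 3).ker → Set.range G := fun u ↦
    ⟨((u : Qˣ) : Q), by
      obtain ⟨r₀, hr₀⟩ := hrange u
      exact ⟨Ideal.Quotient.mk _ r₀, by rw [hG, hr₀]⟩⟩
  have hF : Function.Injective F := by
    intro u u' h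
    have h' : ((u : Qˣ) : Q) = ((u' : Qˣ) : Q) := congrArg Subtype.val h
    exact Subtype.ext (Units.ext h')
  haveI : Finite (Set.range G) := Set.finite_range G |>.to_subtype
  calc Nat.card (@powMonoidHom Qˣ _ 3).ker
      ≤ Nat.card (Set.range G) := Nat.card_le_card_of_injective F hF
    _ ≤ Nat.card (𝓞 K ⧸ Ideal.span {(3 : 𝓞 K)}) :=
        Nat.card_le_card_of_surjective (Set.rangeFactorization G) Set.rangeFactorization_surjective

end SIntegers

end KummerFamily

end Summit.BirchSwinnertonDyer.Rank1Residual.Additive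

end
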